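import Summits.BirchSwinnertonDyer.BirchSwinnertonDyer.Theorems.SylvesterTwoHeegnerIndexCMDataPairTrace
import HarnessLib

/-!
# DATA LAYER (R-e2) of leaf (L1), crux `UpperOffV0HSYPlus` (stmt-BirchSwinnertonDyer-19804): Gross's
# Prop. 3.6 at HSY's frame for a PAIR of Kolyvagin primes — `[D_ℓ D_ℓ' y_{ℓℓ'}]` is fixed by
# `Gal(K[9pℓℓ']/K[9p])` modulo `2^M` (the level of the classes `c_B(ℓℓ')` of (L1))

Skeleton of record VARIANT M (`Cruxes/UpperOffV0HSYPlus/Lines/coupled_variantM.lean` 406ca288e244d392);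
line card v24, residual (R); sibling `…CMDataPairTrace` (generation `Gal(K[n]/K[9p]) ≤ G_ℓ ⊔ G_ℓ'` and the
two (ES1) instances).  This file:

* `exists_zsmul_eq_pointGalHom_derivOp_derivOp_sub` — **Gross 3.6 for the pair**: for `σ_ℓ`, `σ_ℓ'`
  generators of `G_ℓ = Gal(K[n]/K[9pℓ'])`, `G_ℓ' = Gal(K[n]/K[9pℓ])` (`n = 9p(ℓℓ')`), `2^M ∣ ℓ+1, ℓ'+1, a_ℓ, a_ℓ'`,
  every `g ∈ Gal(K[n]/K[9p])` moves `D_ℓ (D_ℓ' y_{ℓℓ'})` inside `2^M · E(K[n])`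
  (`KolyvaginEuler.smul_grAct_derivProd_sub_mem` in the group ring of the ABELIAN `Gal(K[n]/K)` — x11b3
  `KolyvaginH44.isMulCommutative_ringClassGal'` — with `L = {ℓ, ℓ'}`, then `smul_sub_mem_of_mem_closure`);
* `exists_zsmul_eq_map_derivOp_derivOp_sub_of_fix` — the `hfin` shape consumed by
  `exists_fixedPoints_zsmul_eq_of_finite_level` (whence R0's `hP` at the two-prime level exactly as in #R-c).

HONEST FRAMING: theorems only (no definition, no named fact, no instance, no notation); assembly of PROVED
tree theorems; nothing about Sel/Ш/FLIP/display/BSD; no stub closed; `--supports stmt-BirchSwinnertonDyer-19804 --as helper`.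

## References
* B. H. Gross, LMS LNS 153 (1991), §3 (3.3), (3.5), Prop. 3.6, Prop. 3.7 (1). [GrossLMS1991]
* W. G. McCallum, same volume, §4 (4) (p. 300). [McCallumLMS1991]
* Y. Hu, J. Shu, H. Yin, Trans. AMS 372 (2019), arXiv 1708.05266 §4.1. [HuShuYin2019]

## Mathlib / tree search
Tree: `KolyvaginEuler.smul_grAct_derivProd_sub_mem`, `grAct_traceElt_mem_of_eq_smul`, `smul_sub_mem_of_mem_closure`,
`grAct_mul`, `grAct_derivElt`; x11b3 `KolyvaginH44.isMulCommutative_ringClassGal'`,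
`RingClassTower.orderOf_eq_succ_of_zpowers_eq_ringClassGalOver`, `sum_range_pow_eq_sum_image`,
`mem_image_pow_iff_mem_ringClassGalOver`; sibling `ringClassGalOver_nine_mul_le_sup`, `…_pair_left/right`.
`lean search 'derivOp.*derivOp'` → nothing before this file. presearch: n/a (assembly).
-/

set_option linter.dupNamespace false -- Summits modules are `Summit.<Summit>.<Problem>…` by design

noncomputable section

open scoped Classical

namespace Summit.BirchSwinnertonDyer.BirchSwinnertonDyer.Theorems.SylvesterTwoCMData

open Complex UpperHalfPlane NumberField WeierstrassCurve Finset
open Literature.NumberTheory.EllipticCurves Literature.NumberTheory.EllipticCurves.ModularForms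
  Literature.NumberTheory.EllipticCurves.HuShuYin2019
  Literature.NumberTheory.QuadraticFields.BinaryQuadraticForm
  Literature.NumberTheory.QuadraticFields.Quadratic
  Literature.NumberTheory.QuadraticFields Literature.NumberTheory.QuadraticFields.RingClass
  Literature.NumberTheory.EllipticCurves.KolyvaginEuler
  Summit.BirchSwinnertonDyer.Rank1Residual.X11b.RingClassTower
  Summit.BirchSwinnertonDyer.Rank1Residual.X11b

variable {K : Type} [Field K] [NumberField K]

/-! ### Gross's Prop. 3.6 for the pair -/

set_option maxHeartbeats 800000 in -- two (ES1) instances + Gross's §3 algebra in one assembly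
/-- **`g (D_ℓ D_ℓ' y) − D_ℓ D_ℓ' y ∈ 2^M · E(K[9p(ℓℓ')])` for every `g ∈ Gal(K[9pℓℓ']/K[9p])`** (Gross 1991
Prop. 3.6 / McCallum (4) at HSY's frame, two Kolyvagin primes): `σ_ℓ`, `σ_ℓ'` generators of
`G_ℓ = Gal(·/K[9pℓ'])`, `G_ℓ' = Gal(·/K[9pℓ])`, `D_q = Σ_{i ≤ q} i σ_q^i` (`KolyvaginOperator.derivOp`),
`2^M ∣ ℓ + 1, ℓ' + 1, a_ℓ, a_ℓ'`: each `σ_q` fixes `[D_ℓ D_ℓ' y]` by (3.5) + (ES1) at `q` (group ring of the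
ABELIAN `Gal(K[n]/K)`, `KolyvaginEuler.smul_grAct_derivProd_sub_mem`), and `Gal(·/K[9p]) = G_ℓ · G_ℓ'`.
[cite: GrossLMS1991, §3 (3.3), (3.5), Prop. 3.6] [cite: McCallumLMS1991, §4 (4) (p. 300)] -/
theorem exists_zsmul_eq_pointGalHom_derivOp_derivOp_sub (hK : IsImaginaryQuadratic K)
    (hdK : NumberField.discr K = -3) (ι : K →+* ℂ) {W : WeierstrassCurve ℚ}
    (Dt : ModularParametrizationData W 243) {p ℓ ℓ' : ℕ} (hp : p % 3 = 1) (hℓ : ℓ.Prime)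
    (hℓ3 : ℓ % 3 = 2) (hℓ' : ℓ'.Prime) (hℓ'3 : ℓ' % 3 = 2) (hne : ℓ ≠ ℓ') (hℓp : ¬ ℓ ∣ p)
    (hℓ'p : ¬ ℓ' ∣ p) (hinert : (Ideal.span {(ℓ : 𝓞 K)}).IsPrime)
    (hinert' : (Ideal.span {(ℓ' : 𝓞 K)}).IsPrime) {M : ℕ} (hMℓ : 2 ^ M ∣ ℓ + 1) (hMℓ' : 2 ^ M ∣ ℓ' + 1)
    (hMa : ((2 ^ M : ℕ) : ℤ) ∣ W.LFunction ℓ) (hMa' : ((2 ^ M : ℕ) : ℤ) ∣ W.LFunction ℓ')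
    {σ σ' : ringClassField K ι (9 * p * (ℓ * ℓ')) ≃ₐ[ℚ] ringClassField K ι (9 * p * (ℓ * ℓ'))}
    (hσ : Subgroup.zpowers σ = ringClassGalOver ι (9 * p * (ℓ * ℓ')) (9 * p * ℓ'))
    (hσ' : Subgroup.zpowers σ' = ringClassGalOver ι (9 * p * (ℓ * ℓ')) (9 * p * ℓ))
    {y yℓ yℓ' : (W.baseChange (ringClassField K ι (9 * p * (ℓ * ℓ')))).toAffine.Point}
    (hy : Affine.Point.map (W' := W) (ringClassField K ι (9 * p * (ℓ * ℓ'))).subtype.toRatAlgHom y =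
      Dt.φ (heegnerTau (((ℓ * ℓ' : ℕ) : ℤ) ^ 2 * (81 * ((p : ℤ) ^ 2 + 4 * p + 16)),
        ((ℓ * ℓ' : ℕ) : ℤ) * (-(9 * (4 * (p : ℤ) ^ 2 + 17 * p + 72))), 4 * (p : ℤ) ^ 2 + 18 * p + 81)))
    (hyℓ : Affine.Point.map (W' := W) (ringClassField K ι (9 * p * (ℓ * ℓ'))).subtype.toRatAlgHom yℓ =
      Dt.φ (heegnerTau ((ℓ : ℤ) ^ 2 * (81 * ((p : ℤ) ^ 2 + 4 * p + 16)),
        (ℓ : ℤ) * (-(9 * (4 * (p : ℤ) ^ 2 + 17 * p + 72))), 4 * (p : ℤ) ^ 2 + 18 * p + 81)))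
    (hyℓ' : Affine.Point.map (W' := W) (ringClassField K ι (9 * p * (ℓ * ℓ'))).subtype.toRatAlgHom yℓ' =
      Dt.φ (heegnerTau ((ℓ' : ℤ) ^ 2 * (81 * ((p : ℤ) ^ 2 + 4 * p + 16)),
        (ℓ' : ℤ) * (-(9 * (4 * (p : ℤ) ^ 2 + 17 * p + 72))), 4 * (p : ℤ) ^ 2 + 18 * p + 81)))
    {g : ringClassField K ι (9 * p * (ℓ * ℓ')) ≃ₐ[ℚ] ringClassField K ι (9 * p * (ℓ * ℓ'))}
    (hg : g ∈ ringClassGalOver ι (9 * p * (ℓ * ℓ')) (9 * p)) :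
    ∃ a₀ : (W.baseChange (ringClassField K ι (9 * p * (ℓ * ℓ')))).toAffine.Point,
      ((2 ^ M : ℕ) : ℤ) • a₀ =
        pointGalHom W (ringClassField K ι (9 * p * (ℓ * ℓ'))) g
            (KolyvaginOperator.derivOp (pointGalHom W (ringClassField K ι (9 * p * (ℓ * ℓ')))) σ ℓ
              (KolyvaginOperator.derivOp (pointGalHom W (ringClassField K ι (9 * p * (ℓ * ℓ')))) σ' ℓ' y)) -
          KolyvaginOperator.derivOp (pointGalHom W (ringClassField K ι (9 * p * (ℓ * ℓ')))) σ ℓ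
            (KolyvaginOperator.derivOp (pointGalHom W (ringClassField K ι (9 * p * (ℓ * ℓ')))) σ' ℓ' y) := by
  have hp0 : p ≠ 0 := by rintro rfl; simp at hp
  have hℓ3ne : ℓ ≠ 3 := by rintro rfl; simp at hℓ3
  have hℓ'3ne : ℓ' ≠ 3 := by rintro rfl; simp at hℓ'3
  have h9 : ∀ {q : ℕ}, q.Prime → q ≠ 3 → ¬ q ∣ 9 := fun {q} hq hq3 h ↦ by
    have h' : q ∣ 3 ^ 2 := by norm_num; exact h
    exact hq3 ((Nat.prime_dvd_prime_iff_eq hq Nat.prime_three).mp (hq.dvd_of_dvd_pow h'))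
  have hℓ9p : ¬ ℓ ∣ 9 * p := fun h ↦ by
    rcases (Nat.Prime.dvd_mul hℓ).mp h with h9' | hp'
    · exact h9 hℓ hℓ3ne h9'
    · exact hℓp hp'
  have hℓ'9p : ¬ ℓ' ∣ 9 * p := fun h ↦ by
    rcases (Nat.Prime.dvd_mul hℓ').mp h with h9' | hp'
    · exact h9 hℓ' hℓ'3ne h9'
    · exact hℓ'p hp'
  have hn0 : 9 * p * (ℓ * ℓ') ≠ 0 := mul_ne_zero (mul_ne_zero (by norm_num) hp0) (mul_ne_zero hℓ.ne_zero hℓ'.ne_zero)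
  have hfℓ' : 9 * p * ℓ' ≠ 0 := mul_ne_zero (mul_ne_zero (by norm_num) hp0) hℓ'.ne_zero
  have hfℓ : 9 * p * ℓ ≠ 0 := mul_ne_zero (mul_ne_zero (by norm_num) hp0) hℓ.ne_zero
  have hunitsℓ' : 2 ≤ 9 * p * ℓ' ∨ NumberField.discr K < -4 := by
    left
    have h1 : 1 ≤ p * ℓ' := Nat.one_le_iff_ne_zero.mpr (mul_ne_zero hp0 hℓ'.ne_zero)
    have h2 : 9 * p * ℓ' = 9 * (p * ℓ') := by ring
    omega
  have hunitsℓ : 2 ≤ 9 * p * ℓ ∨ NumberField.discr K < -4 := by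
    left
    have h1 : 1 ≤ p * ℓ := Nat.one_le_iff_ne_zero.mpr (mul_ne_zero hp0 hℓ.ne_zero)
    have h2 : 9 * p * ℓ = 9 * (p * ℓ) := by ring
    omega
  have hlevℓ : ℓ * (9 * p * ℓ') = 9 * p * (ℓ * ℓ') := by ring
  have hlevℓ' : ℓ' * (9 * p * ℓ) = 9 * p * (ℓ * ℓ') := by ring
  -- the ABELIAN group `𝒢 = Gal(K[n]/K)` acting on `A = E(K[n])` through `pointGalHom`
  haveI : IsMulCommutative (ringClassGal ι (9 * p * (ℓ * ℓ'))) := KolyvaginH44.isMulCommutative_ringClassGal' hK ι _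
  letI : CommGroup (ringClassGal ι (9 * p * (ℓ * ℓ'))) :=
    { (inferInstance : Group (ringClassGal ι (9 * p * (ℓ * ℓ')))) with mul_comm := mul_comm' }
  letI act : DistribMulAction (ringClassGal ι (9 * p * (ℓ * ℓ')))
      ((W.baseChange (ringClassField K ι (9 * p * (ℓ * ℓ')))).toAffine.Point) :=
    DistribMulAction.compHom _
      ((pointGalHom W (ringClassField K ι (9 * p * (ℓ * ℓ')))).comp (ringClassGal ι (9 * p * (ℓ * ℓ'))).subtype)
  have hsmul : ∀ (h : ringClassGal ι (9 * p * (ℓ * ℓ')))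
      (Q : (W.baseChange (ringClassField K ι (9 * p * (ℓ * ℓ')))).toAffine.Point),
      h • Q = pointGalHom W (ringClassField K ι (9 * p * (ℓ * ℓ')))
        (h : ringClassField K ι (9 * p * (ℓ * ℓ')) ≃ₐ[ℚ] ringClassField K ι (9 * p * (ℓ * ℓ'))) Q :=
    fun _ _ ↦ rfl
  -- the generators as elements of `𝒢`
  have hσG : σ ∈ ringClassGal ι (9 * p * (ℓ * ℓ')) :=
    ringClassGalOver_le_ringClassGal ι _ _ (hσ ▸ Subgroup.mem_zpowers σ)
  have hσ'G : σ' ∈ ringClassGal ι (9 * p * (ℓ * ℓ')) :=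
    ringClassGalOver_le_ringClassGal ι _ _ (hσ' ▸ Subgroup.mem_zpowers σ')
  set s : ringClassGal ι (9 * p * (ℓ * ℓ')) := ⟨σ, hσG⟩ with hs
  set s' : ringClassGal ι (9 * p * (ℓ * ℓ')) := ⟨σ', hσ'G⟩ with hs'
  set sf : ℕ → ringClassGal ι (9 * p * (ℓ * ℓ')) := fun q ↦ if q = ℓ then s else s' with hsf
  have hsfℓ : sf ℓ = s := by simp [hsf]
  have hsfℓ' : sf ℓ' = s' := by simp [hsf, hne.symm]
  have hs_pow : ∀ i : ℕ, ((s ^ i : ringClassGal ι (9 * p * (ℓ * ℓ'))) :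
      ringClassField K ι (9 * p * (ℓ * ℓ')) ≃ₐ[ℚ] ringClassField K ι (9 * p * (ℓ * ℓ'))) = σ ^ i := fun i ↦ by
    rw [Subgroup.coe_pow]
  have hs'_pow : ∀ i : ℕ, ((s' ^ i : ringClassGal ι (9 * p * (ℓ * ℓ'))) :
      ringClassField K ι (9 * p * (ℓ * ℓ')) ≃ₐ[ℚ] ringClassField K ι (9 * p * (ℓ * ℓ'))) = σ' ^ i := fun i ↦ by
    rw [Subgroup.coe_pow]
  -- `D_ℓ D_ℓ' y` in the group-ring currency
  have hDℓ' : grAct ((W.baseChange (ringClassField K ι (9 * p * (ℓ * ℓ')))).toAffine.Point) (derivElt s' ℓ') y =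
      KolyvaginOperator.derivOp (pointGalHom W (ringClassField K ι (9 * p * (ℓ * ℓ')))) σ' ℓ' y := by
    rw [grAct_derivElt]
    unfold KolyvaginOperator.derivOp
    refine Finset.sum_congr rfl fun i _ ↦ ?_
    rw [hsmul, hs'_pow]
  have hD : grAct ((W.baseChange (ringClassField K ι (9 * p * (ℓ * ℓ')))).toAffine.Point) (derivProd sf {ℓ, ℓ'}) y =
      KolyvaginOperator.derivOp (pointGalHom W (ringClassField K ι (9 * p * (ℓ * ℓ')))) σ ℓ
        (KolyvaginOperator.derivOp (pointGalHom W (ringClassField K ι (9 * p * (ℓ * ℓ')))) σ' ℓ' y) := by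
    rw [derivProd, Finset.prod_pair hne, hsfℓ, hsfℓ', grAct_mul, hDℓ', grAct_derivElt]
    unfold KolyvaginOperator.derivOp
    refine Finset.sum_congr rfl fun i _ ↦ ?_
    rw [hsmul, hs_pow]
  -- orders
  have hdivℓ : 9 * p * (ℓ * ℓ') / ℓ = 9 * p * ℓ' := by
    rw [show 9 * p * (ℓ * ℓ') = 9 * p * ℓ' * ℓ by ring, Nat.mul_div_cancel _ hℓ.pos]
  have hdivℓ' : 9 * p * (ℓ * ℓ') / ℓ' = 9 * p * ℓ := by
    rw [show 9 * p * (ℓ * ℓ') = 9 * p * ℓ * ℓ' by ring, Nat.mul_div_cancel _ hℓ'.pos]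
  have hℓℓ' : ¬ ℓ ∣ 9 * p * ℓ' := fun h ↦ by
    rcases (Nat.Prime.dvd_mul hℓ).mp h with h1 | h2
    · exact hℓ9p h1
    · exact hne ((Nat.prime_dvd_prime_iff_eq hℓ hℓ').mp h2)
  have hℓ'ℓ : ¬ ℓ' ∣ 9 * p * ℓ := fun h ↦ by
    rcases (Nat.Prime.dvd_mul hℓ').mp h with h1 | h2
    · exact hℓ'9p h1
    · exact hne ((Nat.prime_dvd_prime_iff_eq hℓ' hℓ).mp h2).symm
  have hordσ : orderOf σ = ℓ + 1 :=
    orderOf_eq_succ_of_zpowers_eq_ringClassGalOver hK ι hℓ hinert ⟨9 * p * ℓ', by ring⟩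
      (by rw [hdivℓ]; exact hℓℓ') hn0 (by rw [hdivℓ]; exact hunitsℓ') (by rw [hdivℓ]; exact hσ)
  have hordσ' : orderOf σ' = ℓ' + 1 :=
    orderOf_eq_succ_of_zpowers_eq_ringClassGalOver hK ι hℓ' hinert' ⟨9 * p * ℓ, by ring⟩
      (by rw [hdivℓ']; exact hℓ'ℓ) hn0 (by rw [hdivℓ']; exact hunitsℓ) (by rw [hdivℓ']; exact hσ')
  have hord : ∀ q ∈ ({ℓ, ℓ'} : Finset ℕ), sf q ^ (q + 1) = 1 := by
    intro q hq
    rw [Finset.mem_insert, Finset.mem_singleton] at hq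
    rcases hq with rfl | rfl
    · rw [hsfℓ]; apply Subtype.ext
      rw [Subgroup.coe_pow, Subgroup.coe_one, ← hordσ, pow_orderOf_eq_one]
    · rw [hsfℓ']; apply Subtype.ext
      rw [Subgroup.coe_pow, Subgroup.coe_one, ← hordσ', pow_orderOf_eq_one]
  have hdvd : ∀ q ∈ ({ℓ, ℓ'} : Finset ℕ), ((2 ^ M : ℕ) : ℤ) ∣ ((q + 1 : ℕ) : ℤ) := by
    intro q hq
    rw [Finset.mem_insert, Finset.mem_singleton] at hq
    rcases hq with rfl | rfl
    · exact_mod_cast hMℓ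
    · exact_mod_cast hMℓ'
  -- traces (ES1) in range form
  have hσd : Subgroup.zpowers σ = ringClassGalOver ι (9 * p * (ℓ * ℓ')) (9 * p * (ℓ * ℓ') / ℓ) := by
    rw [hdivℓ]; exact hσ
  have hσ'd : Subgroup.zpowers σ' = ringClassGalOver ι (9 * p * (ℓ * ℓ')) (9 * p * (ℓ * ℓ') / ℓ') := by
    rw [hdivℓ']; exact hσ'
  have htrℓ : grAct ((W.baseChange (ringClassField K ι (9 * p * (ℓ * ℓ')))).toAffine.Point) (traceElt s ℓ) y =
      W.LFunction ℓ • yℓ' := by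
    rw [grAct_traceElt]
    have : ∀ i ∈ Finset.range (ℓ + 1), s ^ i • y =
        pointGalHom W (ringClassField K ι (9 * p * (ℓ * ℓ'))) (σ ^ i) y := fun i _ ↦ by rw [hsmul, hs_pow]
    rw [Finset.sum_congr rfl this, sum_range_pow_eq_sum_image hK ι hlevℓ hℓ hinert hℓℓ' hfℓ' hunitsℓ' hσd
      (fun g ↦ pointGalHom W (ringClassField K ι (9 * p * (ℓ * ℓ'))) g y)]
    exact sum_pointGalHom_eq_lFunction_smul_sylvester_pair_left hK hdK ι Dt hp hℓ hℓ3 hℓ' hℓ'3 hne hℓp hinert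
      (fun g ↦ mem_image_pow_iff_mem_ringClassGalOver hK ι hlevℓ hℓ hinert hℓℓ' hfℓ' hunitsℓ' hσd g) hy hyℓ'
  have htrℓ' : grAct ((W.baseChange (ringClassField K ι (9 * p * (ℓ * ℓ')))).toAffine.Point) (traceElt s' ℓ') y =
      W.LFunction ℓ' • yℓ := by
    rw [grAct_traceElt]
    have : ∀ i ∈ Finset.range (ℓ' + 1), s' ^ i • y =
        pointGalHom W (ringClassField K ι (9 * p * (ℓ * ℓ'))) (σ' ^ i) y := fun i _ ↦ by rw [hsmul, hs'_pow]
    rw [Finset.sum_congr rfl this, sum_range_pow_eq_sum_image hK ι hlevℓ' hℓ' hinert' hℓ'ℓ hfℓ hunitsℓ hσ'd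
      (fun g ↦ pointGalHom W (ringClassField K ι (9 * p * (ℓ * ℓ'))) g y)]
    exact sum_pointGalHom_eq_lFunction_smul_sylvester_pair_right hK hdK ι Dt hp hℓ hℓ3 hℓ' hℓ'3 hne hℓ'p hinert'
      (fun g ↦ mem_image_pow_iff_mem_ringClassGalOver hK ι hlevℓ' hℓ' hinert' hℓ'ℓ hfℓ hunitsℓ hσ'd g) hy hyℓ
  have htr : ∀ q ∈ ({ℓ, ℓ'} : Finset ℕ),
      grAct ((W.baseChange (ringClassField K ι (9 * p * (ℓ * ℓ')))).toAffine.Point) (traceElt (sf q) q) y ∈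
        zsmulRange ((W.baseChange (ringClassField K ι (9 * p * (ℓ * ℓ')))).toAffine.Point) ((2 ^ M : ℕ) : ℤ) := by
    intro q hq
    rw [Finset.mem_insert, Finset.mem_singleton] at hq
    rcases hq with rfl | rfl
    · rw [hsfℓ]; exact grAct_traceElt_mem_of_eq_smul htrℓ hMa
    · rw [hsfℓ']; exact grAct_traceElt_mem_of_eq_smul htrℓ' hMa'
  -- Prop. 3.6 for each generator, then for `Gal(K[n]/K[9p]) ≤ closure {σ, σ'}`
  have hgenq : ∀ q ∈ ({ℓ, ℓ'} : Finset ℕ),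
      sf q • grAct _ (derivProd sf {ℓ, ℓ'}) y - grAct _ (derivProd sf {ℓ, ℓ'}) y ∈
        zsmulRange ((W.baseChange (ringClassField K ι (9 * p * (ℓ * ℓ')))).toAffine.Point) ((2 ^ M : ℕ) : ℤ) :=
    fun q hq ↦ smul_grAct_derivProd_sub_mem (y := y) hord hdvd htr hq
  have hgG : g ∈ ringClassGal ι (9 * p * (ℓ * ℓ')) := ringClassGalOver_le_ringClassGal ι _ _ hg
  have hg2 : g ∈ Subgroup.zpowers σ ⊔ Subgroup.zpowers σ' := by
    rw [hσ, hσ']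
    exact ringClassGalOver_nine_mul_le_sup hK ι hp0 hℓ hℓ' hne hℓ9p hℓ'9p hg
  have hsub : Subgroup.zpowers σ ⊔ Subgroup.zpowers σ' ≤
      (Subgroup.closure (sf '' (({ℓ, ℓ'} : Finset ℕ) : Set ℕ))).map (ringClassGal ι (9 * p * (ℓ * ℓ'))).subtype := by
    have hℓmem : s ∈ Subgroup.closure (sf '' (({ℓ, ℓ'} : Finset ℕ) : Set ℕ)) :=
      Subgroup.subset_closure ⟨ℓ, by simp, hsfℓ⟩
    have hℓ'mem : s' ∈ Subgroup.closure (sf '' (({ℓ, ℓ'} : Finset ℕ) : Set ℕ)) :=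
      Subgroup.subset_closure ⟨ℓ', by simp, hsfℓ'⟩
    refine sup_le ?_ ?_
    · rw [Subgroup.zpowers_le]
      exact Subgroup.mem_map.mpr ⟨s, hℓmem, rfl⟩
    · rw [Subgroup.zpowers_le]
      exact Subgroup.mem_map.mpr ⟨s', hℓ'mem, rfl⟩
  obtain ⟨g', hg', hgg'⟩ := Subgroup.mem_map.mp (hsub hg2)
  have hg'eq : g' = ⟨g, hgG⟩ := Subtype.ext hgg'
  have hall := smul_sub_mem_of_mem_closure
    (B := zsmulRange ((W.baseChange (ringClassField K ι (9 * p * (ℓ * ℓ')))).toAffine.Point) ((2 ^ M : ℕ) : ℤ))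
    (fun h b hb ↦ smul_mem_zsmulRange h hb)
    (x := grAct _ (derivProd sf {ℓ, ℓ'}) y) (S := sf '' (({ℓ, ℓ'} : Finset ℕ) : Set ℕ))
    (fun s'' hs'' ↦ by
      obtain ⟨q, hq, rfl⟩ := hs''
      exact hgenq q (by exact_mod_cast hq)) hg'
  obtain ⟨a₀, ha₀⟩ := (mem_zsmulRange_iff).mp hall
  refine ⟨a₀, ?_⟩
  rw [ha₀, hsmul, hD, hg'eq]

/-- **The `hfin` shape for the pair**: for every `τ ∈ Aut(K[9p(ℓℓ')]/K)` fixing `K[9p(ℓℓ')] ∩ K[9p]`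
pointwise, `∃ a₀, 2^M • a₀ = τ(D_ℓ D_ℓ' y) − D_ℓ D_ℓ' y` — the hypothesis `hfin` of
`exists_fixedPoints_zsmul_eq_of_finite_level` (whence R0's `hP` at the two-prime level, as in #R-c).
[cite: GrossLMS1991, §3 Prop. 3.6, §4 (4.1)] [cite: McCallumLMS1991, §4 (4)] -/
theorem exists_zsmul_eq_map_derivOp_derivOp_sub_of_fix (hK : IsImaginaryQuadratic K)
    (hdK : NumberField.discr K = -3) (ι : K →+* ℂ) {W : WeierstrassCurve ℚ}
    (Dt : ModularParametrizationData W 243) {p ℓ ℓ' : ℕ} (hp : p % 3 = 1) (hℓ : ℓ.Prime)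
    (hℓ3 : ℓ % 3 = 2) (hℓ' : ℓ'.Prime) (hℓ'3 : ℓ' % 3 = 2) (hne : ℓ ≠ ℓ') (hℓp : ¬ ℓ ∣ p)
    (hℓ'p : ¬ ℓ' ∣ p) (hinert : (Ideal.span {(ℓ : 𝓞 K)}).IsPrime)
    (hinert' : (Ideal.span {(ℓ' : 𝓞 K)}).IsPrime) {M : ℕ} (hMℓ : 2 ^ M ∣ ℓ + 1) (hMℓ' : 2 ^ M ∣ ℓ' + 1)
    (hMa : ((2 ^ M : ℕ) : ℤ) ∣ W.LFunction ℓ) (hMa' : ((2 ^ M : ℕ) : ℤ) ∣ W.LFunction ℓ')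
    {σ σ' : ringClassField K ι (9 * p * (ℓ * ℓ')) ≃ₐ[ℚ] ringClassField K ι (9 * p * (ℓ * ℓ'))}
    (hσ : Subgroup.zpowers σ = ringClassGalOver ι (9 * p * (ℓ * ℓ')) (9 * p * ℓ'))
    (hσ' : Subgroup.zpowers σ' = ringClassGalOver ι (9 * p * (ℓ * ℓ')) (9 * p * ℓ))
    {y yℓ yℓ' : (W.baseChange (ringClassField K ι (9 * p * (ℓ * ℓ')))).toAffine.Point}
    (hy : Affine.Point.map (W' := W) (ringClassField K ι (9 * p * (ℓ * ℓ'))).subtype.toRatAlgHom y =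
      Dt.φ (heegnerTau (((ℓ * ℓ' : ℕ) : ℤ) ^ 2 * (81 * ((p : ℤ) ^ 2 + 4 * p + 16)),
        ((ℓ * ℓ' : ℕ) : ℤ) * (-(9 * (4 * (p : ℤ) ^ 2 + 17 * p + 72))), 4 * (p : ℤ) ^ 2 + 18 * p + 81)))
    (hyℓ : Affine.Point.map (W' := W) (ringClassField K ι (9 * p * (ℓ * ℓ'))).subtype.toRatAlgHom yℓ =
      Dt.φ (heegnerTau ((ℓ : ℤ) ^ 2 * (81 * ((p : ℤ) ^ 2 + 4 * p + 16)),
        (ℓ : ℤ) * (-(9 * (4 * (p : ℤ) ^ 2 + 17 * p + 72))), 4 * (p : ℤ) ^ 2 + 18 * p + 81)))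
    (hyℓ' : Affine.Point.map (W' := W) (ringClassField K ι (9 * p * (ℓ * ℓ'))).subtype.toRatAlgHom yℓ' =
      Dt.φ (heegnerTau ((ℓ' : ℤ) ^ 2 * (81 * ((p : ℤ) ^ 2 + 4 * p + 16)),
        (ℓ' : ℤ) * (-(9 * (4 * (p : ℤ) ^ 2 + 17 * p + 72))), 4 * (p : ℤ) ^ 2 + 18 * p + 81))) :
    ∀ τ : ringClassField K ι (9 * p * (ℓ * ℓ')) ≃ₐ[K] ringClassField K ι (9 * p * (ℓ * ℓ')),
      (∀ x ∈ {x : ringClassField K ι (9 * p * (ℓ * ℓ')) | (x : ℂ) ∈ ringClassField K ι (9 * p)}, τ x = x) →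
      ∃ a₀ : (W.baseChange (ringClassField K ι (9 * p * (ℓ * ℓ')))).toAffine.Point,
        ((2 ^ M : ℕ) : ℤ) • a₀ =
          Affine.Point.map (W' := W)
              (τ : ringClassField K ι (9 * p * (ℓ * ℓ')) →+* ringClassField K ι (9 * p * (ℓ * ℓ'))).toRatAlgHom
              (KolyvaginOperator.derivOp (pointGalHom W (ringClassField K ι (9 * p * (ℓ * ℓ')))) σ ℓ
                (KolyvaginOperator.derivOp (pointGalHom W (ringClassField K ι (9 * p * (ℓ * ℓ')))) σ' ℓ' y)) -
            KolyvaginOperator.derivOp (pointGalHom W (ringClassField K ι (9 * p * (ℓ * ℓ')))) σ ℓ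
              (KolyvaginOperator.derivOp (pointGalHom W (ringClassField K ι (9 * p * (ℓ * ℓ')))) σ' ℓ' y) := by
  intro τ hτ
  have hg : τ.restrictScalars ℚ ∈ ringClassGalOver ι (9 * p * (ℓ * ℓ')) (9 * p) := by
    rw [ringClassGalOver, mem_fixingSubgroup_iff]
    intro x hx
    exact hτ x hx
  obtain ⟨a₀, ha₀⟩ := exists_zsmul_eq_pointGalHom_derivOp_derivOp_sub hK hdK ι Dt hp hℓ hℓ3 hℓ' hℓ'3 hne hℓp
    hℓ'p hinert hinert' hMℓ hMℓ' hMa hMa' hσ hσ' hy hyℓ hyℓ' hg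
  refine ⟨a₀, ?_⟩
  rw [ha₀, pointGalHom_apply]
  rfl

end Summit.BirchSwinnertonDyer.BirchSwinnertonDyer.Theorems.SylvesterTwoCMData

end
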